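import Literature.NumberTheory.Sieve.HeathBrownCubicFLAssembly
import Literature.NumberTheory.Sieve.HeathBrownMorozClassFLSequences
import Literature.NumberTheory.Sieve.HeathBrownMorozClassSingularSeries
import HarnessLib

/-!
# The `𝒜`-side of the Fundamental-Lemma comparison for a residue class (HBM Lemma 3.1, I)

Pure-proof file in the residue-class ("coset") port of D. R. Heath-Brown, *Primes represented by
`x³ + 2y³`*, Acta Math. 186 (2001), §6 (proof of Lemma 3.5), to the class `x ≡ a, y ≡ b (mod d)`
of Heath-Brown–Moroz, Proc. LMS 88 (2004) (their Lemma 3.1): the class analogues of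
`abs_TpieceA_sub_le` and `sum_remaindersA_le` of `HeathBrownCubicFLAssembly`, on the class
sequence `classSeqA` of `HeathBrownMorozClassFLSequences`, together with the arithmetic that makes
the class main terms proportional to Heath-Brown's:
* for `z > d` the density product of the class is `V_{𝒜_f}(z) = V_𝒜(z)·∏_{p∣d}(1 − ν_p/(p+1))⁻¹`
  (`classProd_eq`) and the chain sums coincide (`classChainSum_eq`: chains consist of primes
  `≥ X^τ > d`);
* `w(d) = classWeight d = (ζ(2)/ζ_d(2))·∏_{p∣d}(1 − ν_p/(p+1))⁻¹` (`classWeight_eq`), so that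
  `X_{𝒜_f}V_{𝒜_f} = (w(d)/d²)·X_𝒜V_𝒜` (`classSizeA_mul_classProd`): the class main terms are
  `w(d)/d²` times Heath-Brown's, which is why the comparison constant of [HBM, (3.1)] is
  `classKappa = (w(d)/d²)κ`;
* **`abs_TpieceClassA_sub_le`**:
  `|T^(n)(𝒜_f) − X_{𝒜_f}V_{𝒜_f}(z)Σ₀(n)| ≤ C_FL X_{𝒜_f}V_{𝒜_f}(z)e^{-s}Σ₀(n) + (remainders)`
  by `hasSieveDimension_classDensA`, through (6.1) = `Tpiece_classPairs_eq`);
* **`sum_remaindersClassA_le`**: the remainders are controlled by the class level of distribution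
  (`HeathBrownMorozClassLevel.class_level`): the moduli `qe` are distinct square-free numbers
  `≤ X^{1+τ}D ≤ X^{3/2}` (proof of `sum_remaindersA_le` verbatim).
[cite: HeathBrownMoroz2004, Lemma 3.1 and (3.1)] [cite: HeathBrownActa2001, §6 (6.1)–(6.3), p. 35]
Search: `lean search 'TpieceA_sub_le|sum_remaindersA_le|classWeight'` — the `d = 1` versions and the
definition of `classWeight`; nothing for the class.
-/

noncomputable section

open NumberField Finset Filter

open scoped Topology

namespace Literature.NumberTheory.Sieve.CubicSieve

open LFunctions.CubeRootTwoField CubicPrimes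

/-! ### The class density product and chain sums against Heath-Brown's -/

/-- The density product of `(𝒜_f)_q` at `P(z)` is `∏_{p<z}(1 − Γ(p))` (for every `q`).
[cite: HeathBrownMoroz2004, Lemma 2.4] -/
theorem densityProduct_classSeqA (X η : ℝ) (d a b q : ℕ) (z : ℝ) :
    (classSeqA X η d a b q).densityProduct (primesProdBelow z) =
      ∏ p ∈ Nat.primesBelow ⌈z⌉₊, (1 - classDensA d p) := by
  rw [SieveSequence.densityProduct, primeFactors_primesProdBelow]
  rfl

/-- `Γ(p) = [p ∤ d]·ρ₀(p)/p` at a prime. [cite: HeathBrownMoroz2004, Lemma 2.4] -/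
theorem classDensA_prime (d : ℕ) {p : ℕ} (hp : p.Prime) :
    classDensA d p = if p ∣ d then 0 else densA p := by
  rw [classDensA_apply d hp.ne_zero, densA_apply hp.ne_zero, hp.primeFactors, prod_singleton,
    prod_singleton]

/-- **`V_{𝒜_f}(z) = V_𝒜(z)·∏_{p∣d}(1 − ν_p/(p+1))⁻¹` for `z > d`** (the primes `p ∣ d` are `< z` and
carry the factor `1` instead of `1 − ρ₀(p)/p`). [cite: HeathBrownMoroz2004, Lemma 2.4 (iv)] -/
theorem classProd_eq {d : ℕ} (hd : 0 < d) {z : ℝ} (hz : (d : ℝ) < z) :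
    ∏ p ∈ Nat.primesBelow ⌈z⌉₊, (1 - classDensA d p) =
      prodA z * ∏ p ∈ d.primeFactors, (1 - densA p)⁻¹ := by
  have hdz : d < ⌈z⌉₊ := Nat.lt_ceil.mpr hz
  rw [prodA, ← filter_dvd_primesBelow_eq hd hdz, prod_filter, ← prod_mul_distrib]
  refine prod_congr rfl fun p hp => ?_
  have hpp := Nat.prime_of_mem_primesBelow hp
  rw [classDensA_prime d hpp]
  split_ifs with hpd
  · have h1 : (1 : ℝ) - densA p ≠ 0 := by
      have := (hasSieveDimension_densA.1 p hpp).2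
      linarith
    rw [sub_zero, mul_inv_cancel₀ h1]
  · rw [mul_one]

/-- **The class chain sums are Heath-Brown's** for `X^τ > d`: the chains of (6.1) consist of primes
`≥ X^τ > d`, at which `Γ = ρ₀/p`. [cite: HeathBrownMoroz2004, Lemma 3.1] -/
theorem classChainSum_eq {d : ℕ} (hd : 0 < d) {X τ : ℝ} (hz : (d : ℝ) < X ^ τ) (n : ℕ) :
    ∑ t ∈ ratChains X τ n, classDensA d (∏ p ∈ t, p) = chainSumA X τ n := by
  rw [chainSumA]
  refine sum_congr rfl fun t ht => ?_
  obtain ⟨htsub, -, -⟩ := mem_ratChains_iff.mp ht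
  have htp : ∀ p ∈ t, p.Prime := fun p hp => (mem_ratSmallPrimes_iff.mp (htsub hp)).1
  have hne : ∏ p ∈ t, p ≠ 0 := prod_ne_zero_iff.mpr fun p hp => (htp p hp).ne_zero
  have hcop : Nat.Coprime d (∏ p ∈ t, p) := by
    refine Nat.Coprime.prod_right fun p hp => ?_
    have hge : X ^ τ ≤ (p : ℝ) := (mem_ratSmallPrimes_iff.mp (htsub hp)).2.1
    have hpd : ¬ p ∣ d := fun h => by
      have : (p : ℝ) ≤ d := by exact_mod_cast Nat.le_of_dvd hd h
      linarith
    exact ((Nat.Prime.coprime_iff_not_dvd (htp p hp)).mpr hpd).symm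
  rw [classDensA_eq_ite d hne, if_pos hcop]

/-- **`w(d) = (ζ(2)/ζ_d(2))·∏_{p∣d}(1 − ν_p/(p+1))⁻¹`**: the weight `classWeight d` of [HBM, (3.1)]
is the coprimality correction times the missing local factors of `V_𝒜`
(`w(p) = p²(p+1)/((p²−1)(p+1−ν_p)) = (1 − p⁻²)⁻¹(1 − ν_p/(p+1))⁻¹`).
[cite: HeathBrownMoroz2004, (3.1) and Lemma 2.4] -/
theorem classWeight_eq (d : ℕ) :
    classWeight d = zetaTwoCorrection d * ∏ p ∈ d.primeFactors, (1 - densA p)⁻¹ := by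
  rw [classWeight_def, zetaTwoCorrection_def, ← prod_mul_distrib]
  refine prod_congr rfl fun p hp => ?_
  have hpp := Nat.prime_of_mem_primeFactors hp
  have hp2 : (2 : ℝ) ≤ p := by exact_mod_cast hpp.two_le
  have hp0 : (p : ℝ) ≠ 0 := by positivity
  have hp1 : (p : ℝ) + 1 ≠ 0 := by positivity
  have e1 : 1 - ((p : ℝ) ^ 2)⁻¹ = ((p : ℝ) ^ 2 - 1) / (p : ℝ) ^ 2 := by field_simp
  have e2 : 1 - (cubeRootTwoCount p : ℝ) / ((p : ℝ) + 1) =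
      ((p : ℝ) + 1 - cubeRootTwoCount p) / ((p : ℝ) + 1) := by field_simp
  rw [classWeightFactor_def, densA_prime hpp, e1, e2, inv_div, inv_div, div_mul_div_comm]

/-- **`X_{𝒜_f}·V_{𝒜_f}(z) = (w(d)/d²)·X_𝒜·V_𝒜(z)` for `z > d`** — the class main terms are `w(d)/d²`
times Heath-Brown's (so the comparison constant is `classKappa = (w(d)/d²)κ`).
[cite: HeathBrownMoroz2004, (3.1)] -/
theorem classSizeA_mul_classProd {d : ℕ} (hd : 0 < d) {z : ℝ} (hz : (d : ℝ) < z) (X η : ℝ) :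
    classSizeA X η d * ∏ p ∈ Nat.primesBelow ⌈z⌉₊, (1 - classDensA d p) =
      classWeight d / (d : ℝ) ^ 2 * (sizeA X η * prodA z) := by
  rw [classProd_eq hd hz, classWeight_eq, classSizeA_eq]
  ring

/-! ### The Fundamental Lemma for the class pieces -/

open scoped Classical in
/-- **`|T^(n)(𝒜_f) − X_{𝒜_f}V_{𝒜_f}(z)Σ₀(n)|`
`≤ C_FL X_{𝒜_f}V_{𝒜_f}(z)e^{-s}Σ₀(n) + ∑_t∑_{e∣P(z), e≤D}|R_e((𝒜_f)_{∏t})|`**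
with `V_{𝒜_f}(z) = V_𝒜(z)∏_{p∣d}(1 − ν_p/(p+1))⁻¹` (`z = X^τ > d`): the Fundamental Lemma for each
`(𝒜_f)_q`, `q = ∏t`, through (6.1) for the class (`Tpiece_classPairs_eq`) — the class analogue of
`abs_TpieceA_sub_le`.
[cite: HeathBrownMoroz2004, Lemma 3.1] [cite: HeathBrownActa2001, §6 (6.2)–(6.3)] -/
theorem abs_TpieceClassA_sub_le {C_FL : ℝ} (hFL : FLBound dimConst C_FL) {d : ℕ} (hd : 0 < d)
    (a b : ℕ) {X η τ D : ℝ} (hX : 0 ≤ X) (hz : 2 ≤ X ^ τ) (hdz : (d : ℝ) < X ^ τ)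
    (hzD : X ^ τ ≤ D) (n : ℕ) :
    |(Tpiece (classPairs X η d a b) pairIdeal X τ n : ℝ) -
        classSizeA X η d * (prodA (X ^ τ) * ∏ p ∈ d.primeFactors, (1 - densA p)⁻¹) *
          chainSumA X τ n| ≤
      C_FL * classSizeA X η d * (prodA (X ^ τ) * ∏ p ∈ d.primeFactors, (1 - densA p)⁻¹) *
          Real.exp (-(Real.log D / Real.log (X ^ τ))) * chainSumA X τ n +
        ∑ t ∈ ratChains X τ n,
          ∑ e ∈ (primesProdBelow (X ^ τ)).divisors.filter (fun e : ℕ => (e : ℝ) ≤ D),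
            |(classSeqA X η d a b (∏ p ∈ t, p)).remainder e (topA X η)| := by
  rw [Tpiece_classPairs_eq hX, ← classChainSum_eq hd hdz, ← classProd_eq hd hdz, mul_sum, mul_sum,
    ← sum_sub_distrib, ← sum_add_distrib]
  refine (abs_sum_le_sum_abs _ _).trans (sum_le_sum fun t _ => ?_)
  set q := ∏ p ∈ t, p
  have hsize : 0 ≤ (classSeqA X η d a b q).size (topA X η) := by
    show 0 ≤ classSizeA X η d * classDensA d q
    exact mul_nonneg (classSizeA_nonneg X η d) (classDensA_nonneg_and_le d q).1
  have h := hFL (classSeqA X η d a b q) (hasSieveDimension_classDensA d) (topA X η) (X ^ τ) D hz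
    hzD hsize
  rw [densityProduct_classSeqA] at h
  have hsz : (classSeqA X η d a b q).size (topA X η) = classSizeA X η d * classDensA d q := rfl
  rw [hsz] at h
  rw [show classSizeA X η d * (∏ p ∈ Nat.primesBelow ⌈X ^ τ⌉₊, (1 - classDensA d p)) *
      classDensA d q = classSizeA X η d * classDensA d q *
        ∏ p ∈ Nat.primesBelow ⌈X ^ τ⌉₊, (1 - classDensA d p) by ring]
  refine h.trans (le_of_eq ?_)
  ring

/-! ### The class remainders against the class level of distribution -/

open scoped Classical in
/-- **The class `𝒜`-remainders are controlled by the class level of distribution.** For `X ≥ 1`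
and `DX^{1+τ} ≤ X^{3/2}`:
`∑_{n<N}∑_{t ∈ ratChains n}∑_{e∣P(X^τ), e≤D} |R_e((𝒜_f)_{∏t})|
   ≤ ∑_{N(R) ≤ X^{3/2}, N(R) square-free} |#𝒜_R(class) − [(d,N R)=1]X_{𝒜_f}ρ₂(R)/N(R)|`
(each remainder is a sum over the ideals of norm `qe`, `abs_remainder_classSeqA_le`; the moduli
`qe` are distinct square-free numbers `≤ X^{1+τ}D` — the proof of `sum_remaindersA_le`).
[cite: HeathBrownMoroz2004, Lemma 3.1] [cite: HeathBrownActa2001, §6 p. 35] -/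
theorem sum_remaindersClassA_le (d a b : ℕ) {X η τ D : ℝ} (hX : 1 ≤ X)
    (hD : D * X ^ (1 + τ) ≤ X ^ (3 / 2 : ℝ)) (N : ℕ) :
    ∑ n ∈ range N, ∑ t ∈ ratChains X τ n,
        ∑ e ∈ (primesProdBelow (X ^ τ)).divisors.filter (fun e : ℕ => (e : ℝ) ≤ D),
          |(classSeqA X η d a b (∏ p ∈ t, p)).remainder e (topA X η)| ≤
      ∑ R ∈ (idealsLE ⌊X ^ (3 / 2 : ℝ)⌋₊).filter (fun R => Squarefree (Ideal.absNorm R)),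
        |(classCountA X η d a b R : ℝ) -
          (if Nat.Coprime d (Ideal.absNorm R) then
            classSizeA X η d * rho₂ R / Ideal.absNorm R else 0)| := by
  set z := X ^ τ with hz
  set Dset := (primesProdBelow z).divisors.filter (fun e : ℕ => (e : ℝ) ≤ D) with hDset
  set g : Ideal (𝓞 K) → ℝ := fun R => |(classCountA X η d a b R : ℝ) -
    (if Nat.Coprime d (Ideal.absNorm R) then classSizeA X η d * rho₂ R / Ideal.absNorm R else 0)|
    with hg
  have hg0 : ∀ R, 0 ≤ g R := fun R => abs_nonneg _
  have hX0 : 0 ≤ X := by linarith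
  -- Step 1: each remainder through the ideals of norm `qe`
  have hstep1 : ∀ n, ∀ t ∈ ratChains X τ n, ∀ e ∈ Dset,
      |(classSeqA X η d a b (∏ p ∈ t, p)).remainder e (topA X η)| ≤
        ∑ R ∈ normEq ((∏ p ∈ t, p) * e), g R := by
    intro n t ht e he
    have heP : e ∣ primesProdBelow z := Nat.dvd_of_mem_divisors (mem_filter.mp he).1
    exact abs_remainder_classSeqA_le hX0 η d a b (coprime_prod_ratChain ht heP).2
  -- Step 2: flatten the index set
  set U := (range N).biUnion (fun n => ratChains X τ n) with hU
  have hUdisj : (↑(range N) : Set ℕ).PairwiseDisjoint (fun n => ratChains X τ n) := by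
    intro n _ m _ hnm
    rw [Function.onFun, Finset.disjoint_left]
    intro t ht ht'
    exact hnm ((mem_ratChains_iff.mp ht).2.1.symm.trans (mem_ratChains_iff.mp ht').2.1)
  set f : Finset ℕ × ℕ → ℕ := fun x => (∏ p ∈ x.1, p) * x.2 with hf
  -- the chains are coprime to `P(z)`
  have hcP : ∀ {n : ℕ} {t : Finset ℕ}, t ∈ ratChains X τ n →
      (∏ p ∈ t, p).Coprime (primesProdBelow z) := by
    intro n t ht
    refine Nat.coprime_of_dvd fun k hk hkq hkP => ?_
    obtain ⟨htsub, -, -⟩ := mem_ratChains_iff.mp ht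
    obtain ⟨p, hp, hkp⟩ := (Nat.Prime.prime hk).dvd_finsetProd_iff _ |>.mp hkq
    have hkp' : k = p :=
      (Nat.prime_dvd_prime_iff_eq hk (mem_ratSmallPrimes_iff.mp (htsub hp)).1).mp hkp
    subst hkp'
    have h1 : X ^ τ ≤ (k : ℝ) := (mem_ratSmallPrimes_iff.mp (htsub hp)).2.1
    have h2 : (k : ℝ) < X ^ τ := (dvd_primesProdBelow_iff hk (X ^ τ)).mp hkP
    linarith
  -- injectivity of `(t, e) ↦ ∏t·e` on `U × Dset`
  have hinj : Set.InjOn f ↑(U ×ˢ Dset) := by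
    rintro ⟨t, e⟩ hx ⟨t', e'⟩ hx' heq
    simp only [coe_product, Set.mem_prod, mem_coe, hU, mem_biUnion] at hx hx'
    obtain ⟨⟨n, -, ht⟩, he⟩ := hx
    obtain ⟨⟨n', -, ht'⟩, he'⟩ := hx'
    have heP : e ∣ primesProdBelow z := Nat.dvd_of_mem_divisors (mem_filter.mp he).1
    have heP' : e' ∣ primesProdBelow z := Nat.dvd_of_mem_divisors (mem_filter.mp he').1
    simp only [hf] at heq
    have hee : e = e' := by
      have e1 : ((∏ p ∈ t, p) * e).gcd (primesProdBelow z) = e := by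
        rw [Nat.Coprime.gcd_mul_left_cancel e (hcP ht), Nat.gcd_eq_left heP]
      have e2 : ((∏ p ∈ t', p) * e').gcd (primesProdBelow z) = e' := by
        rw [Nat.Coprime.gcd_mul_left_cancel e' (hcP ht'), Nat.gcd_eq_left heP']
      rw [← e1, ← e2, heq]
    subst hee
    have he0 : e ≠ 0 := fun h =>
      primesProdBelow_ne_zero z (by rw [h] at heP; exact zero_dvd_iff.mp heP)
    have hqq : ∏ p ∈ t, p = ∏ p ∈ t', p := Nat.eq_of_mul_eq_mul_right (Nat.pos_of_ne_zero he0) heq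
    have htt : t = t' := by
      have h1 := Nat.primeFactors_prod fun p hp =>
        (mem_ratSmallPrimes_iff.mp ((mem_ratChains_iff.mp ht).1 hp)).1
      have h2 := Nat.primeFactors_prod fun p hp =>
        (mem_ratSmallPrimes_iff.mp ((mem_ratChains_iff.mp ht').1 hp)).1
      rw [← h1, ← h2, hqq]
    rw [htt]
  -- the fibres `normEq (f x)` are pairwise disjoint on `U × Dset`
  have hdisj : (↑(U ×ˢ Dset) : Set (Finset ℕ × ℕ)).PairwiseDisjoint (fun x => normEq (f x)) := by
    intro x hx y hy hxy
    rw [Function.onFun, Finset.disjoint_left]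
    intro R hR hR'
    rw [mem_normEq] at hR hR'
    exact hxy (hinj hx hy (hR.symm.trans hR'))
  -- the union of the fibres lies in the target set
  have hsub : (U ×ˢ Dset).biUnion (fun x => normEq (f x)) ⊆
      (idealsLE ⌊X ^ (3 / 2 : ℝ)⌋₊).filter (fun R => Squarefree (Ideal.absNorm R)) := by
    intro R hR
    rw [mem_biUnion] at hR
    obtain ⟨⟨t, e⟩, hx, hR⟩ := hR
    rw [mem_product, hU, mem_biUnion] at hx
    obtain ⟨⟨n, -, ht⟩, he⟩ := hx
    rw [mem_normEq] at hR
    have heP : e ∣ primesProdBelow z := Nat.dvd_of_mem_divisors (mem_filter.mp he).1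
    have heD : (e : ℝ) ≤ D := (mem_filter.mp he).2
    obtain ⟨-, -, hlt⟩ := mem_ratChains_iff.mp ht
    rw [mem_filter, mem_idealsLE, hR]
    refine ⟨Nat.le_floor ?_, (coprime_prod_ratChain ht heP).2⟩
    simp only [hf]
    push_cast
    have hlt' : (∏ i ∈ t, (i : ℝ)) < X ^ (1 + τ) := by rw [← Nat.cast_prod]; exact hlt
    have hq0 : (0 : ℝ) ≤ ∏ i ∈ t, (i : ℝ) := prod_nonneg fun i _ => Nat.cast_nonneg i
    have he0 : (0 : ℝ) ≤ e := Nat.cast_nonneg _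
    calc (∏ i ∈ t, (i : ℝ)) * e ≤ X ^ (1 + τ) * D := mul_le_mul hlt'.le heD he0 (by positivity)
      _ ≤ X ^ (3 / 2 : ℝ) := by rw [mul_comm]; exact hD
  -- put everything together
  calc ∑ n ∈ range N, ∑ t ∈ ratChains X τ n, ∑ e ∈ Dset,
          |(classSeqA X η d a b (∏ p ∈ t, p)).remainder e (topA X η)|
      ≤ ∑ n ∈ range N, ∑ t ∈ ratChains X τ n, ∑ e ∈ Dset,
          ∑ R ∈ normEq ((∏ p ∈ t, p) * e), g R :=
        sum_le_sum fun n _ => sum_le_sum fun t ht => sum_le_sum fun e he => hstep1 n t ht e he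
    _ = ∑ t ∈ U, ∑ e ∈ Dset, ∑ R ∈ normEq ((∏ p ∈ t, p) * e), g R := by
        rw [hU, sum_biUnion hUdisj]
    _ = ∑ x ∈ U ×ˢ Dset, ∑ R ∈ normEq (f x), g R := by rw [sum_product]
    _ = ∑ R ∈ (U ×ˢ Dset).biUnion (fun x => normEq (f x)), g R := (sum_biUnion hdisj).symm
    _ ≤ _ := sum_le_sum_of_subset_of_nonneg hsub fun R _ _ => hg0 R

end Literature.NumberTheory.Sieve.CubicSieve

end
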